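import Literature.RepresentationTheory.MoeglinVignerasWaldspurger1987.RankOneThetaLiftSeparation
import Literature.RepresentationTheory.MoeglinVignerasWaldspurger1987.RankOneThetaLiftLinesDisjointHolds
import HarnessLib

/-!
# [Liu2021, Lem. D.1 (3)] at `n = 3`, non-split `v`: the `(ε, χ)`-clauses UNCONDITIONALLY
# (§3 of `RankOneThetaLiftSeparation` with row IV-4(c1) discharged by `rankOne_theta_lines_disjoint_holds`)

Topic `RepresentationTheory/MoeglinVignerasWaldspurger1987`; theorems only (no definition, no named fact).

`RankOneThetaLiftSeparation.lean` §3 (B-p13) derives the `(ε, χ)`-clauses of [Liu2021, App. D Lem. D.1 (3)] at `n = 3` and a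
non-split place from the named fact IV-4(c1) `rankOne_theta_lines_disjoint` carried as a hypothesis `h`.  That fact is now a
THEOREM (`rankOne_theta_lines_disjoint_holds`, `RankOneThetaLiftLinesDisjointHolds.lean`, anisotropic-doubling / root-subgroup
support argument of the cell `hodgecm-mathlib`), so the two clauses hold with `h` discharged — binders otherwise VERBATIM those of
§3:

* `rankOne_theta_epsClass_and_char_eq_of_areIsomorphicRep_unconditional` — `Θ_{s₁}(χ₁) ≠ 0`, `Θ_{s₁}(χ₁) ≅ Θ_{s₂}(χ₂)`
  ⟹ `ε₂ ∈ ε₁ · Nm E_vˣ` and `χ₁ = χ₂`;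
* `rankOne_theta_sameClass_and_char_eq_of_areIsomorphicRep_unconditional` — the same with the `ε`-conjunct in the
  `LemD1.SameClass` currency of `LemD1_3AsPrintedI`.

HC_CM is proved only modulo the printed citations until rung 0 of the ladder closes; nothing of [Liu2021] beyond what these
theorems state is asserted.

## References
* [Liu2021] Y. Liu, Camb. J. Math. 9 (2021) = arXiv:2102.11518 — App. D Lem. D.1 (3) (l. 5233), proof l. 5255.
* [MoeglinVignerasWaldspurger1987] C. Mœglin, M.-F. Vignéras, J.-L. Waldspurger, LNM 1291 (1987), Chap. 3 §IV.
-/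

noncomputable section

namespace Literature.RepresentationTheory.MoeglinVignerasWaldspurger1987

open NumberField IsDedekindDomain
open scoped Matrix
open Literature.RepresentationTheory.HeisenbergGroup (MpPsi)
open Literature.NumberTheory.GelbartRogawski1991.UnitaryDualPair.LocalSplitting (iota LocalMp localSchrodinger)
open Literature.NumberTheory.Automorphic (SchwartzBruhat UnitaryGroup.localPi UnitaryGroup.localCenter UnitaryGroup.LocalRing
  UnitaryGroup.localCenter_comm UnitaryGroup.conjLocal)
open Literature.NumberTheory.Automorphic.Liu2021 (AreIsomorphicRep LemD1.SameClass LemD1OfPlace.eps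
  LemD1OfPlace.eps_mem_skew LemD1OfPlace.standingData)


/-- **[Liu2021, App. D Lem. D.1 (3)], `(ε, χ)`-clauses at `n = 3` and a non-split place — UNCONDITIONAL**: if the
`χ₁`-coinvariants of `ω_{s₁}` under the centre are non-zero and `Θ_{s₁}(χ₁) ≅ Θ_{s₂}(χ₂)` as representations of `U(J)(F_v)`,
then `ε₁, ε₂` lie in the same class of `E_v^{−×}/Nm E_vˣ` (`∃ x, ε₂ = x · xᶜ · ε₁`) and `χ₁ = χ₂` — §3's
`rankOne_theta_epsClass_and_char_eq_of_areIsomorphicRep` with its hypothesis `h` discharged by `rankOne_theta_lines_disjoint_holds`.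
[cite: Liu2021, App. D Lemma D.1 (3) (l. 5233) and proof l. 5255] -/
theorem rankOne_theta_epsClass_and_char_eq_of_areIsomorphicRep_unconditional
    (F : Type) [Field F] [NumberField F] (E : Type) [Field E] [NumberField E] [Algebra F E]
    [Algebra.IsQuadraticExtension F E] (c : E ≃ₐ[F] E)
    (δ₁ : E) (hcδ₁ : c δ₁ = -δ₁) (hδ₁ : δ₁ ≠ 0) (d₁ : F) (hd₁ : δ₁ * δ₁ = algebraMap F E d₁)
    (δ₂ : E) (hcδ₂ : c δ₂ = -δ₂) (hδ₂ : δ₂ ≠ 0) (d₂ : F) (hd₂ : δ₂ * δ₂ = algebraMap F E d₂)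
    (T : Matrix (Fin 3) (Fin 3) F) (hT : T.IsSymm) (hTd : IsUnit T.det)
    (J : Matrix (Fin 3) (Fin 3) E) (hJ : J = T.map (algebraMap F E)) (v : HeightOneSpectrum (𝓞 F))
    (hE : IsField (UnitaryGroup.LocalRing E v))
    (s₁ s₂ : UnitaryGroup.localPi E c 3 J v →* LocalMp F 3 T v)
    (hs₁ : ∀ g, MpPsi.proj _ (s₁ g) = iota F E c 3 hcδ₁ hδ₁ hd₁ T hT hJ v g)
    (hs₂ : ∀ g, MpPsi.proj _ (s₂ g) = iota F E c 3 hcδ₂ hδ₂ hd₂ T hT hJ v g)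
    (hsm₁ : Representation.IsSmooth ((MpPsi.toRep (localSchrodinger F 3 T v)).comp s₁))
    (hsm₂ : Representation.IsSmooth ((MpPsi.toRep (localSchrodinger F 3 T v)).comp s₂))
    (J₁ : Matrix (Fin 1) (Fin 1) E) (hJ₁ : J₁ 0 0 ≠ 0) (χ₁ χ₂ : UnitaryGroup.localPi E c 1 J₁ v →* ℂˣ)
    (hχ₁u : ∀ z, ‖((χ₁ z : ℂˣ) : ℂ)‖ = 1) (hχ₁c : Continuous fun z => ((χ₁ z : ℂˣ) : ℂ))
    (hχ₂u : ∀ z, ‖((χ₂ z : ℂˣ) : ℂ)‖ = 1) (hχ₂c : Continuous fun z => ((χ₂ z : ℂˣ) : ℂ))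
    (hnt : Nontrivial (TwistedCoinv.Coinv
      ((show Representation ℂ (UnitaryGroup.localPi E c 1 J₁ v) (SchwartzBruhat (Fin 3 → v.adicCompletion F)) from
        ((MpPsi.toRep (localSchrodinger F 3 T v)).comp s₁).comp (UnitaryGroup.localCenter E c 3 J J₁ hJ₁ v))) χ₁))
    (hiso : AreIsomorphicRep
      (TwistedCoinv.rep
        (ρW := show Representation ℂ (UnitaryGroup.localPi E c 1 J₁ v) (SchwartzBruhat (Fin 3 → v.adicCompletion F)) from
          ((MpPsi.toRep (localSchrodinger F 3 T v)).comp s₁).comp (UnitaryGroup.localCenter E c 3 J J₁ hJ₁ v))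
        χ₁ ((MpPsi.toRep (localSchrodinger F 3 T v)).comp s₁)
        (fun g z => (show Commute g (UnitaryGroup.localCenter E c 3 J J₁ hJ₁ v z) from
          UnitaryGroup.localCenter_comm E c 3 J J₁ hJ₁ v z g).map ((MpPsi.toRep (localSchrodinger F 3 T v)).comp s₁)))
      (TwistedCoinv.rep
        (ρW := show Representation ℂ (UnitaryGroup.localPi E c 1 J₁ v) (SchwartzBruhat (Fin 3 → v.adicCompletion F)) from
          ((MpPsi.toRep (localSchrodinger F 3 T v)).comp s₂).comp (UnitaryGroup.localCenter E c 3 J J₁ hJ₁ v))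
        χ₂ ((MpPsi.toRep (localSchrodinger F 3 T v)).comp s₂)
        (fun g z => (show Commute g (UnitaryGroup.localCenter E c 3 J J₁ hJ₁ v z) from
          UnitaryGroup.localCenter_comm E c 3 J J₁ hJ₁ v z g).map ((MpPsi.toRep (localSchrodinger F 3 T v)).comp s₂)))) :
    (∃ x : (UnitaryGroup.LocalRing E v)ˣ,
      LemD1OfPlace.eps E v hδ₂ = x * Units.map (UnitaryGroup.conjLocal E c v : UnitaryGroup.LocalRing E v →* UnitaryGroup.LocalRing E v) x *
        LemD1OfPlace.eps E v hδ₁) ∧ χ₁ = χ₂ :=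
  rankOne_theta_epsClass_and_char_eq_of_areIsomorphicRep rankOne_theta_lines_disjoint_holds F E c δ₁ hcδ₁ hδ₁ d₁ hd₁ δ₂ hcδ₂ hδ₂
    d₂ hd₂ T hT hTd J hJ v hE s₁ s₂ hs₁ hs₂ hsm₁ hsm₂ J₁ hJ₁ χ₁ χ₂ hχ₁u hχ₁c hχ₂u hχ₂c hnt hiso

/-- **The same in the `LemD1.SameClass` currency of `LemD1_3AsPrintedI` — UNCONDITIONAL**: `Θ_{s₁}(χ₁) ≠ 0` and
`Θ_{s₁}(χ₁) ≅ Θ_{s₂}(χ₂)` give `LemD1.SameClass ⟨ε₁, _⟩ ⟨ε₂, _⟩` and `χ₁ = χ₂` (§3's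
`rankOne_theta_sameClass_and_char_eq_of_areIsomorphicRep` with `h := rankOne_theta_lines_disjoint_holds`).
[cite: Liu2021, App. D Lemma D.1 (3) (l. 5233) and §D.1 Step 1 (l. 5217)] -/
theorem rankOne_theta_sameClass_and_char_eq_of_areIsomorphicRep_unconditional
    (F : Type) [Field F] [NumberField F] (E : Type) [Field E] [NumberField E] [Algebra F E]
    [Algebra.IsQuadraticExtension F E] (c : E ≃ₐ[F] E)
    (δ₁ : E) (hcδ₁ : c δ₁ = -δ₁) (hδ₁ : δ₁ ≠ 0) (d₁ : F) (hd₁ : δ₁ * δ₁ = algebraMap F E d₁)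
    (δ₂ : E) (hcδ₂ : c δ₂ = -δ₂) (hδ₂ : δ₂ ≠ 0) (d₂ : F) (hd₂ : δ₂ * δ₂ = algebraMap F E d₂)
    (T : Matrix (Fin 3) (Fin 3) F) (hT : T.IsSymm) (hTd : IsUnit T.det)
    (J : Matrix (Fin 3) (Fin 3) E) (hJ : J = T.map (algebraMap F E)) (hJh : (J.map c)ᵀ = J) (hJdet : J.det ≠ 0)
    (v : HeightOneSpectrum (𝓞 F)) (hE : IsField (UnitaryGroup.LocalRing E v))
    (s₁ s₂ : UnitaryGroup.localPi E c 3 J v →* LocalMp F 3 T v)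
    (hs₁ : ∀ g, MpPsi.proj _ (s₁ g) = iota F E c 3 hcδ₁ hδ₁ hd₁ T hT hJ v g)
    (hs₂ : ∀ g, MpPsi.proj _ (s₂ g) = iota F E c 3 hcδ₂ hδ₂ hd₂ T hT hJ v g)
    (hsm₁ : Representation.IsSmooth ((MpPsi.toRep (localSchrodinger F 3 T v)).comp s₁))
    (hsm₂ : Representation.IsSmooth ((MpPsi.toRep (localSchrodinger F 3 T v)).comp s₂))
    (J₁ : Matrix (Fin 1) (Fin 1) E) (hJ₁ : J₁ 0 0 ≠ 0) (χ₁ χ₂ : UnitaryGroup.localPi E c 1 J₁ v →* ℂˣ)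
    (hχ₁u : ∀ z, ‖((χ₁ z : ℂˣ) : ℂ)‖ = 1) (hχ₁c : Continuous fun z => ((χ₁ z : ℂˣ) : ℂ))
    (hχ₂u : ∀ z, ‖((χ₂ z : ℂˣ) : ℂ)‖ = 1) (hχ₂c : Continuous fun z => ((χ₂ z : ℂˣ) : ℂ))
    (hnt : Nontrivial (TwistedCoinv.Coinv
      ((show Representation ℂ (UnitaryGroup.localPi E c 1 J₁ v) (SchwartzBruhat (Fin 3 → v.adicCompletion F)) from
        ((MpPsi.toRep (localSchrodinger F 3 T v)).comp s₁).comp (UnitaryGroup.localCenter E c 3 J J₁ hJ₁ v))) χ₁))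
    (hiso : AreIsomorphicRep
      (TwistedCoinv.rep
        (ρW := show Representation ℂ (UnitaryGroup.localPi E c 1 J₁ v) (SchwartzBruhat (Fin 3 → v.adicCompletion F)) from
          ((MpPsi.toRep (localSchrodinger F 3 T v)).comp s₁).comp (UnitaryGroup.localCenter E c 3 J J₁ hJ₁ v))
        χ₁ ((MpPsi.toRep (localSchrodinger F 3 T v)).comp s₁)
        (fun g z => (show Commute g (UnitaryGroup.localCenter E c 3 J J₁ hJ₁ v z) from
          UnitaryGroup.localCenter_comm E c 3 J J₁ hJ₁ v z g).map ((MpPsi.toRep (localSchrodinger F 3 T v)).comp s₁)))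
      (TwistedCoinv.rep
        (ρW := show Representation ℂ (UnitaryGroup.localPi E c 1 J₁ v) (SchwartzBruhat (Fin 3 → v.adicCompletion F)) from
          ((MpPsi.toRep (localSchrodinger F 3 T v)).comp s₂).comp (UnitaryGroup.localCenter E c 3 J J₁ hJ₁ v))
        χ₂ ((MpPsi.toRep (localSchrodinger F 3 T v)).comp s₂)
        (fun g z => (show Commute g (UnitaryGroup.localCenter E c 3 J J₁ hJ₁ v z) from
          UnitaryGroup.localCenter_comm E c 3 J J₁ hJ₁ v z g).map ((MpPsi.toRep (localSchrodinger F 3 T v)).comp s₂)))) :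
    LemD1.SameClass (S := LemD1OfPlace.standingData E v c 3 J hcδ₁ hδ₁ (by norm_num) hJh hJdet)
        ⟨LemD1OfPlace.eps E v hδ₁, LemD1OfPlace.eps_mem_skew E v c 3 J hcδ₁ hδ₁ (by norm_num) hJh hJdet⟩
        ⟨LemD1OfPlace.eps E v hδ₂, eps_mem_skew_of E v c 3 J hcδ₁ hδ₁ (by norm_num) hJh hJdet hδ₂ hcδ₂⟩ ∧
      χ₁ = χ₂ :=
  rankOne_theta_sameClass_and_char_eq_of_areIsomorphicRep rankOne_theta_lines_disjoint_holds F E c δ₁ hcδ₁ hδ₁ d₁ hd₁ δ₂ hcδ₂ hδ₂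
    d₂ hd₂ T hT hTd J hJ hJh hJdet v hE s₁ s₂ hs₁ hs₂ hsm₁ hsm₂ J₁ hJ₁ χ₁ χ₂ hχ₁u hχ₁c hχ₂u hχ₂c hnt hiso

end Literature.RepresentationTheory.MoeglinVignerasWaldspurger1987

end
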